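import Mathlib
import HarnessLib
import Summits.HubbardSuperconductivity.HubbardSuperconductivity.Theorems.KLProgrammeH10TwoPointLimitSectorMultiplierSteps
import Summits.HubbardSuperconductivity.HubbardSuperconductivity.Theorems.KLProgrammeH10TwoPointLimitSectorMultiplierRates

/-!
# Route `KLProgramme` — engine support, route (L2): the UNIFORM `ℓ¹` bound of the space-time character sum of a `klAnisoFamily` pair —
# `Σ_z ‖S_{ω₁ω₂}(z)‖ ≤ C_B · M · L²` with `C_B` INDEPENDENT of the scale, the sectors, `β`, `L`, `M`

Cell `gate-hubbard-kl`, seat p4 (C5a lead), g7.  `charSum_klAnisoPair_le` (`…SectorMultiplierL1`, g6) composed the symbol layer with the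
master lemma at explicit but scale-dependent constants.  Here the same composition is run through the ORIGINAL master lemma
`sum_norm_charSum_le_of_second_differences` (k3c2-p3) with the clean RATES of `…SectorMultiplierRates`
(`s₀ = 2Λβ/(2Mπ√c_G)`, `s₁ = s₃ = 2Λ/(π√κ)`, `s₂ = 4Λ/(LU√κ)`, `U = (2π/L)(2^{n₁} + ½)`, `Λ = Λ_{n₁}`), the tangent step
`v = round(2^{n₁}τ̂)` and `R₀ = ⌊(L−1)/(2|v|₁)⌋` chosen inside the proof, for neighbouring scales `n₂ ≤ n₁ ≤ n₂ + 1` (the engine's pairs),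
under the thresholds `2π·16^{n₁} ≤ L`, `βe₀ ≤ M`, `π/(4β) ≤ Λ_{n₁}` (i.e. `n₁ ≤ n_β + 1`) and `(4π/L)(2^{n₁} + ½) ≤ z`:
**`charSum_klAnisoPair_le_uniform`** — `Σ_z ‖Σ_q χχ • F_{ω₁}F_{ω₂}(k q)‖ ≤ C_B·M·L²`, `C_B = √(2048(π√c_G+1)κ_X·(160/π)c_{N,1}c_{N,2}/e₀)`
explicit in `(d, e₀, A, B_a, s_max, Dt_min, ρ_min)` only; so BGM's (2.71a) overlap size is `B ≤ C_B·M/β`, `ε_x·B ≤ C_B/2` uniformly in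
the scale.  Everything is proved; no definitions, no named facts. [cite: BenfattoGiulianiMastropietro2006, §2.6 (2.81), §2.7 (2.71a)]
-/

noncomputable section

namespace Summit.HubbardSuperconductivity.HubbardSuperconductivity.Theorems.TorusFourierL2

set_option linter.dupNamespace false -- summit = problem name (single-conjunct summit), D-0017

open Set Finset Literature.MathematicalPhysics.QuantumLattice Literature.MathematicalPhysics.QuantumLattice.BandSectorCounting
open Literature.MathematicalPhysics.QuantumLattice.FermiRG Literature.Probability.LatticeModels Literature.Analysis.SpecialFunctions
open Summit.HubbardSuperconductivity.HubbardSuperconductivity.Theorems.DispersionFlow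
open Summit.HubbardSuperconductivity.HubbardSuperconductivity.Theorems.KLRegimeSplit
open Summit.HubbardSuperconductivity.HubbardSuperconductivity.Theorems.KLProgrammeLegKernels
open Summit.HubbardSuperconductivity.HubbardSuperconductivity.Theorems.PerturbedFermiCurve
open scoped Real
section Main
variable {L M : ℕ} [NeZero L] [NeZero M] {a b : ℝ} (B : BandBounds a b) {K : TrigPolyC4v} {A : ℝ}
  (hA : ∀ p : Momentum, ∀ j ≤ 2, ‖iteratedFDeriv ℝ j (frameShift K) p‖ ≤ A) (hADt : 2 * A < B.Dtmin)
  {μ e₀ z β : ℝ} (he : 0 < e₀) (hz : 0 < z) (hz1 : z ≤ 1) (hgap : e₀ + A + z ^ 2 < -μ) (h3 : e₀ + A - μ ≤ 3)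
  (hlo : a ≤ μ - A - e₀) (hhi : μ + A + e₀ ≤ b) (hβ : 0 < β) (hρA : 4 * A < 2 * B.rhomin)
  {n₁ n₂ : ℕ} (hn : n₂ ≤ n₁) (ω₁ : Fin (sectorCount n₁)) (ω₂ : Fin (sectorCount n₂))
  {d : ℝ} (hd : 0 < d) (hd1 : ∀ u, |deriv (bgmCutoffSq e₀) u| ≤ d) (hd2 : ∀ u, |iteratedDeriv 2 (bgmCutoffSq e₀) u| ≤ d)
  {Z : (Fin 2 → ℝ) → ℝ}
  (hZ : ∀ p, Z p = gnCutoff ((π + z) ^ 2 / π ^ 2) ((π + z) ^ 2) (p 0 ^ 2) * gnCutoff ((π + z) ^ 2 / π ^ 2) ((π + z) ^ 2) (p 1 ^ 2) *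
    ((radialCutoffC (1 / 2) (momToComplex p) * sectorWeightCirc n₁ ((ω₁ : ℕ) : ℤ) (polarAngle p)) *
      (radialCutoffC (1 / 2) (momToComplex p) * sectorWeightCirc n₂ ((ω₂ : ℕ) : ℤ) (polarAngle p))))
  {Φ : ℝ × (Fin 2 → ℝ) → ℂ}
  (hΦ : ∀ k₀ p, Φ (k₀, p) = ((bgmCutoffSq e₀ ((16 : ℝ) ^ n₁ * (k₀ ^ 2 + frameLevel μ K (WithLp.toLp 2 p) ^ 2)) *
      bgmCutoffSq e₀ ((16 : ℝ) ^ n₂ * (k₀ ^ 2 + frameLevel μ K (WithLp.toLp 2 p) ^ 2)) * Z p : ℝ) : ℂ))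
  {Gs : TorusSite 1 (2 * M) × TorusSite 2 L → ℂ}
  (hGs : ∀ q, Gs q = klAnisoFamily L M β μ K e₀ n₁ ω₁ (⟨(q.1 0).val, ZMod.val_lt (q.1 0)⟩, q.2) *
    klAnisoFamily L M β μ K e₀ n₂ ω₂ (⟨(q.1 0).val, ZMod.val_lt (q.1 0)⟩, q.2))
  -- the angular constant of `exists_norm_iteratedDeriv_sectorWeightCirc_polarAngle_line_le 2`
  {Ba : ℝ} (hB0 : 0 < Ba)
  (hB : ∀ (i : ℕ), i ≤ 2 → ∀ (n : ℕ) (ω : ℤ) (θ₀ : ℝ) (q w : Fin 2 → ℝ) (t : ℝ) {r₀ : ℝ}, 0 < r₀ →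
    r₀ ≤ ‖momToComplex (q + t • w)‖ → |sectorRelAngle θ₀ (q + t • w)| < π →
    ‖iteratedDeriv i (fun t : ℝ => sectorWeightCirc n ω (polarAngle (q + t • w))) t‖ ≤
      (2 : ℕ).factorial * Ba * ((1 + (sectorWidth n)⁻¹ * (2 : ℕ).factorial) * ‖momToComplex w‖ / r₀) ^ i)
  -- the named constants (parameters with defining equations; instantiate with `rfl`)
  {cG c1 ρb Y κ κX cN1 cN2 : ℝ}
  (hcG : cG = 4 * (d * e₀ ^ 4 * 1 + 2 * (d * e₀ ^ 2) * (d * e₀ ^ 2) + 1 * (d * e₀ ^ 4)) + 2 * (d * e₀ ^ 2 * 1 + 1 * (d * e₀ ^ 2)))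
  (hc1 : c1 = d * e₀ ^ 2 * 1 + 1 * (d * e₀ ^ 2))
  (hρb : ρb = (e₀ + 3 * π / 2 * B.smax * B.Dtmin) / (B.Dtmin - 2 * A))
  (hY : Y = (4 + 2 * A) + (4 + 4 * A) * (2 * ρb + 5))
  (hκ : κ = cG * Y ^ 2 + 2 * c1 * (4 + 4 * A) * (9 / 4) * e₀ + 8 * c1 * Ba * Y * 12 * e₀ + 2 * Ba * 72 * e₀ ^ 2 +
    8 * Ba ^ 2 * 36 * e₀ ^ 2)
  (hκX : κX = 4 * (3 * Real.sqrt 2 * π * Real.sqrt κ + 2 * e₀) ^ 2 / e₀ +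
    96 / (π * e₀ ^ 2) * ((π * Real.sqrt κ / 2) * (π * Real.sqrt κ / 2 + e₀) ^ 2))
  (hcN1 : cN1 = Real.sqrt 2 * (e₀ + (4 + 4 * A) * ρb ^ 2) / ((2 * B.rhomin - 4 * A) * π) + 2)
  (hcN2 : cN2 = 2 * Real.sqrt 2 * ρb / π + 2)

set_option maxHeartbeats 800000 in -- large explicit constants: elaboration of the symbol-layer bounds and their packaging is slow
include B hA hADt he hz hz1 hgap h3 hlo hhi hβ hρA hn hd hd1 hd2 hZ hΦ hGs hB0 hB hcG hc1 hρb hY hκ hκX hcN1 hcN2 in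
/-- **The uniform `ℓ¹` bound of the space-time character sum of `F_{ω₁}F_{ω₂}` on an admissible frame** for neighbouring scales
`n₂ ≤ n₁ ≤ n₂ + 1`: `Σ_z ‖S(z)‖ ≤ √(2048(π√c_G+1)κ_X·(160/π)c_{N,1}c_{N,2}/e₀) · M · L²`, with the constants as in the header — uniform in
the scale `n₁`, the sectors, `β ∈ [π/(4Λ_{n₁}), M/e₀]` and the volume. [cite: BenfattoGiulianiMastropietro2006, §2.6 (2.81), §2.7 (2.71a)] -/
theorem charSum_klAnisoPair_le_uniform (hn1 : n₁ ≤ n₂ + 1) (hM : klScale e₀ n₁ * β < π * (2 * M - 3)) (hMβ : β * e₀ ≤ M)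
    (hLz : 2 * |2 * π / (L : ℝ)| * ((2 : ℝ) ^ n₁ + 1 / 2) ≤ z) (hL16 : 2 * π * (16 : ℝ) ^ n₁ ≤ L)
    (hΛβ : π / (4 * β) ≤ klScale e₀ n₁) :
    ∑ zz : TorusSite 1 (2 * M) × TorusSite 2 L,
        ‖∑ q : TorusSite 1 (2 * M) × TorusSite 2 L, (torusChar q.1 zz.1 * torusChar q.2 zz.2) • Gs q‖ ≤
      Real.sqrt (2048 * (π * Real.sqrt cG + 1) * κX * (160 / π * (cN1 * cN2)) / e₀) * M * (L : ℝ) ^ 2 := by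
  classical
  have hL : (0 : ℝ) < L := Nat.cast_pos.2 (Nat.pos_of_ne_zero (NeZero.ne L))
  have hMpos : (0 : ℝ) < M := Nat.cast_pos.2 (Nat.pos_of_ne_zero (NeZero.ne M))
  have hπ := Real.pi_pos
  have hA0 : 0 ≤ A := le_trans (norm_nonneg _) (hA 0 0 (by norm_num))
  have hlo' : a ≤ μ - A := by linarith
  have hhi' : μ + A ≤ b := by linarith
  have hc : 0 < 2 * π / (L : ℝ) := by positivity
  have habs : |2 * π / (L : ℝ)| = 2 * π / L := abs_of_pos hc
  have hDt : 0 < B.Dtmin - 2 * A := by linarith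
  have hγ : 0 < 2 * B.rhomin - 4 * A := by linarith
  -- the scale bookkeeping: `Λ = e₀ 4^{-n₁}`, `N = 2^{n₁}`, `ΛN² = e₀`
  obtain ⟨hΛN2, hΛe, hΛN, hN2L, hLΛ2, hhN2⟩ := scale_facts he n₁ hL16
  set Λ : ℝ := klScale e₀ n₁ with hΛdef
  set N : ℝ := (2 : ℝ) ^ n₁ with hNdef
  have hΛ : 0 < Λ := by rw [hΛdef, klScale]; positivity
  have hN1 : 1 ≤ N := one_le_pow₀ (by norm_num)
  have hN0 : 0 < N := by positivity
  -- the steps: `h = 2π/L`, `U = h(N + ½)`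
  set U : ℝ := 2 * π / L * (N + 1 / 2) with hUdef
  have hU0 : 0 < U := by positivity
  have hLz' : 2 * (2 * π / (L : ℝ)) * (N + 1 / 2) ≤ z := by rw [habs] at hLz; exact hLz
  have hU : U ≤ 1 / 2 := by rw [hUdef]; linarith only [hLz', hz1]
  have hhU : 2 * π / (L : ℝ) ≤ U := by
    rw [hUdef]
    have := mul_le_mul_of_nonneg_left (show (1 : ℝ) ≤ N + 1 / 2 by linarith only [hN1]) hc.le
    linarith only [this]
  have hh1 : 2 * (2 * π / (L : ℝ)) ≤ 1 := by linarith only [hhU, hU]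
  have hU32 : U ≤ 3 / 2 * (2 * π / (L : ℝ) * N) := by
    rw [hUdef]
    have := mul_le_mul_of_nonneg_left hN1 hc.le
    linarith only [this]
  have hLU : (L : ℝ) * U ≤ 3 * π * N := by
    rw [hUdef]
    have e : (L : ℝ) * (2 * π / L * (N + 1 / 2)) = 2 * π * (N + 1 / 2) := by field_simp
    rw [e]
    have := mul_le_mul_of_nonneg_left hN1 hπ.le
    linarith only [this]
  have hcG0 : 0 < cG := by rw [hcG]; positivity
  have hc10 : 0 ≤ c1 := by rw [hc1]; positivity
  have hρb0 : 0 ≤ ρb := by rw [hρb]; have := B.smax_pos; have := B.Dtmin_pos; positivity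
  have hY0 : 0 ≤ Y := by rw [hY]; positivity
  have hκ0 : 0 < κ := by rw [hκ]; positivity
  have hκX0 : 0 ≤ κX := by rw [hκX]; positivity
  have hcN10 : 0 ≤ cN1 := by rw [hcN1]; positivity
  have hcN20 : 0 ≤ cN2 := by rw [hcN2]; positivity
  -- the cell radius `ρ ≤ ρ̄/N` and the angular factors `Dᵢ ≤ 2N`
  set ρ : ℝ := (klScale e₀ n₁ + B.smax * B.Dtmin * (3 * sectorWidth n₂ / 4)) / (B.Dtmin - 2 * A) with hρdef
  have hρ0 : 0 ≤ ρ := by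
    have := B.smax_pos; have := B.Dtmin_pos; have := sectorWidth_pos n₂; positivity
  have hρN : ρ ≤ ρb / N := by rw [hρdef, hρb]; exact cellRadius_le B hADt hn1 hΛN
  have hρb' : ρ ≤ ρb := hρN.trans (div_le_self hρb0 hN1)
  obtain ⟨hD₁, hD₁0⟩ := angularFactor_le (le_refl n₁)
  obtain ⟨hD₂, hD₂0⟩ := angularFactor_le hn
  -- the tangent step
  set eK : (Fin 2 → ℝ) → ℝ := fun p => frameLevel μ K (WithLp.toLp 2 p) with heK
  set pF : Fin 2 → ℝ := klFermiPoint μ K (sectorCenter n₂ (ω₂ : ℕ)) with hpF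
  have hgrad : ‖fderiv ℝ eK pF‖ ≤ 4 + 2 * A := norm_fderiv_frameBand_le hA μ pF
  have hγ' : 0 < Real.sqrt (fderiv ℝ eK pF (Pi.single 0 1) ^ 2 + fderiv ℝ eK pF (Pi.single 1 1) ^ 2) :=
    lt_of_lt_of_le (by linarith) (gradient_floor_klFermiPoint B hA hlo' hhi' (sectorCenter n₂ (ω₂ : ℕ)))
  set v : Fin 2 → ℤ := ![round (N * (-fderiv ℝ eK pF (Pi.single 1 1) /
      Real.sqrt (fderiv ℝ eK pF (Pi.single 0 1) ^ 2 + fderiv ℝ eK pF (Pi.single 1 1) ^ 2))),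
    round (N * (fderiv ℝ eK pF (Pi.single 0 1) /
      Real.sqrt (fderiv ℝ eK pF (Pi.single 0 1) ^ 2 + fderiv ℝ eK pF (Pi.single 1 1) ^ 2)))] with hvdef
  have hv0 : v 0 = round (N * (-fderiv ℝ eK pF (Pi.single 1 1) /
      Real.sqrt (fderiv ℝ eK pF (Pi.single 0 1) ^ 2 + fderiv ℝ eK pF (Pi.single 1 1) ^ 2))) := by
    rw [hvdef]; rfl
  have hv1 : v 1 = round (N * (fderiv ℝ eK pF (Pi.single 0 1) /
      Real.sqrt (fderiv ℝ eK pF (Pi.single 0 1) ^ 2 + fderiv ℝ eK pF (Pi.single 1 1) ^ 2))) := by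
    rw [hvdef]; rfl
  obtain ⟨hτv, hvsize, hv⟩ := tangentStep_bounds eK pF hgrad hγ' hN1 v hv0 hv1 (2 * π / L)
  have hV : N / 2 ≤ Real.sqrt ((v 0 : ℝ) ^ 2 + (v 1 : ℝ) ^ 2) := half_le_norm_tangentStep hγ' n₁ v hv0 hv1 hv
  obtain ⟨hR₀, hR₀'⟩ := tangentR0_bounds hN1 v hv hvsize (twelve_mul_le_of_step hL hN0 hz1 hLz')
  set R₀ : ℕ := (L - 1) / (2 * ((v 0).natAbs + (v 1).natAbs)) with hR₀def
  -- admissibility of the steps (`4π|u_j| ≤ zL`)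
  have huv : ∀ j, 2 * |2 * π / (L : ℝ)| * |(v j : ℝ)| ≤ z := fun j =>
    (mul_le_mul_of_nonneg_left (hvsize j) (by positivity)).trans hLz
  have huax : ∀ (i j : Fin 2), 2 * |2 * π / (L : ℝ)| * |(((Pi.single i (1 : ℤ) : Fin 2 → ℤ) j : ℤ) : ℝ)| ≤ z := by
    intro i j
    have h1 : |(((Pi.single i (1 : ℤ) : Fin 2 → ℤ) j : ℤ) : ℝ)| ≤ N + 1 / 2 := by
      have : |(((Pi.single i (1 : ℤ) : Fin 2 → ℤ) j : ℤ) : ℝ)| ≤ 1 := by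
        by_cases hj : j = i
        · subst hj; simp
        · simp [hj]
      linarith only [this, hN1]
    exact (mul_le_mul_of_nonneg_left h1 (by positivity)).trans hLz
  have huperp : ∀ j, 2 * |2 * π / (L : ℝ)| * |(((![-v 1, v 0] : Fin 2 → ℤ) j : ℤ) : ℝ)| ≤ z := by
    intro j
    fin_cases j
    · simpa [abs_neg] using huv 1
    · simpa using huv 0
  have hWv : ‖(fun j : Fin 2 => 2 * π / L * (v j : ℝ))‖ ≤ U := by
    refine (pi_norm_le_iff_of_nonneg hU0.le).2 fun j => ?_
    rw [Real.norm_eq_abs, abs_mul, habs, hUdef]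
    exact mul_le_mul_of_nonneg_left (hvsize j) hc.le
  have hWp : ‖(fun j : Fin 2 => 2 * π / L * (((![-v 1, v 0] : Fin 2 → ℤ) j : ℤ) : ℝ))‖ ≤ U := by
    refine (pi_norm_le_iff_of_nonneg hU0.le).2 fun j => ?_
    rw [Real.norm_eq_abs, abs_mul, habs, hUdef]
    refine mul_le_mul_of_nonneg_left ?_ hc.le
    fin_cases j
    · simpa [abs_neg] using hvsize 1
    · simpa using hvsize 0
  have hWmv := norm_momToComplex_le_two_mul hU0.le _ hWv
  have hWmp := norm_momToComplex_le_two_mul hU0.le _ hWp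
  -- the four pointwise bounds in the master lemma's currency
  have hP0 : (0 : ℝ) < ((2 * M : ℕ) : ℝ) := Nat.cast_pos.2 (Nat.pos_of_ne_zero (mul_ne_zero two_ne_zero (NeZero.ne M)))
  have h0' : ∀ q, ‖((fwdDiff ((fun _ : Fin 1 => (1 : ZMod (2 * M))), (0 : TorusSite 2 L)))^[2] Gs) q‖ ≤
      1 * (4 / (2 * Λ * β / (((2 * M : ℕ) : ℝ) * π * Real.sqrt cG) * ((2 * M : ℕ) : ℝ))) ^ 2 := by
    intro q
    have h := norm_fwdDiff_two_time_klAnisoPair_le hA he hz h3 hβ hn ω₁ ω₂ hd.le hd1 hd2 hZ hΦ hGs hM q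
    rw [rate_time_sq hcG0 hΛ hβ hP0, hcG]
    exact h
  -- axes (`s = h`)
  have h1' : ∀ q (i : Fin 2), ‖((fwdDiff ((0 : TorusSite 1 (2 * M)), (Pi.single i (1 : ZMod L) : TorusSite 2 L)))^[2] Gs) q‖ ≤
      1 * (4 / (2 * Λ / (π * Real.sqrt κ) * L)) ^ 2 := by
    intro q i
    have hτ : |fderiv ℝ (fun p : Fin 2 → ℝ => frameLevel μ K (WithLp.toLp 2 p)) (klFermiPoint μ K (sectorCenter n₂ (ω₂ : ℕ)))
        (fun j => 2 * π / L * (((Pi.single i (1 : ℤ) : Fin 2 → ℤ) j : ℤ) : ℝ))| ≤ (4 + 2 * A) * (2 * π / L) := by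
      calc _ ≤ (4 + 2 * A) * ‖(fun j : Fin 2 => 2 * π / L * (((Pi.single i (1 : ℤ) : Fin 2 → ℤ) j : ℤ) : ℝ))‖ :=
            abs_fderiv_frameBand_apply_le hA μ _ _
        _ = (4 + 2 * A) * (2 * π / L) := by rw [(norms_axisStep L i).1]
    have hraw := norm_fwdDiff_two_space_klAnisoPair_le B hA hADt he hz hz1 hgap h3 hlo hhi hn ω₁ ω₂ hd.le hd1 hd2 hZ hΦ hGs hB0.le hB
      (Pi.single i 1) (huax i) hτ q
    rw [(norms_axisStep L i).1, (norms_axisStep L i).2, axisStep_cast] at hraw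
    rw [rate_space_sq hκ0 hΛ hL]
    refine hraw.trans ?_
    rw [← hcG, ← hc1, ← hρdef]
    refine (kx_le (s := 2 * π / L) (Y := Y) (aw := 9 / 4) (ad := 12) (a2 := 72) (a3 := 36) (e₀ := e₀) hcG0.le hc10 hB0.le hA0
      hΛ hρ0 (by positivity) hc.le hc.le hD₁0 hD₂0 hc.le hY0 ?_ ?_ ?_ ?_ ?_).trans (le_of_eq ?_)
    · -- `τ' ≤ hY`
      rw [hY]
      have h1 : ρ + 2 * (2 * π / L) ≤ 2 * ρb + 5 := by linarith only [hρb', hh1, hρb0]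
      have h2 : (4 + 4 * A) * (ρ + 2 * (2 * π / L)) * (2 * π / L) ≤ (4 + 4 * A) * (2 * ρb + 5) * (2 * π / L) := by gcongr
      linarith only [h2]
    · have := mul_le_mul_of_nonneg_left hΛe (sq_nonneg (2 * π / (L : ℝ)))
      have h0 : 0 ≤ (2 * π / (L : ℝ)) ^ 2 * e₀ := by positivity
      linarith only [this, h0]
    · calc ((1 + 2 * (sectorWidth n₁)⁻¹) + (1 + 2 * (sectorWidth n₂)⁻¹)) * (2 * π / L) * Λ ≤ (2 * N + 2 * N) * (2 * π / L) * Λ := by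
            gcongr
        _ = 4 * (2 * π / L) * (Λ * N) := by ring
        _ ≤ 4 * (2 * π / L) * e₀ := by gcongr
        _ ≤ 12 * (2 * π / L) * e₀ := by
            have h0 : 0 ≤ 2 * π / (L : ℝ) * e₀ := by positivity
            linarith only [h0]
    · have hsq₁ : (1 + 2 * (sectorWidth n₁)⁻¹) ^ 2 ≤ (2 * N) ^ 2 := pow_le_pow_left₀ hD₁0 hD₁ 2
      have hsq₂ : (1 + 2 * (sectorWidth n₂)⁻¹) ^ 2 ≤ (2 * N) ^ 2 := pow_le_pow_left₀ hD₂0 hD₂ 2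
      calc ((1 + 2 * (sectorWidth n₁)⁻¹) ^ 2 + (1 + 2 * (sectorWidth n₂)⁻¹) ^ 2) * (2 * π / L) ^ 2 * Λ ^ 2 ≤
          ((2 * N) ^ 2 + (2 * N) ^ 2) * (2 * π / L) ^ 2 * Λ ^ 2 := by gcongr
        _ = 8 * (2 * π / L) ^ 2 * (Λ * N) ^ 2 := by ring
        _ ≤ 8 * (2 * π / L) ^ 2 * e₀ ^ 2 := by gcongr
        _ ≤ 72 * (2 * π / L) ^ 2 * e₀ ^ 2 := by
            have h0 : 0 ≤ (2 * π / (L : ℝ)) ^ 2 * e₀ ^ 2 := by positivity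
            linarith only [h0]
    · calc (1 + 2 * (sectorWidth n₁)⁻¹) * (1 + 2 * (sectorWidth n₂)⁻¹) * (2 * π / L) ^ 2 * Λ ^ 2 ≤
          (2 * N) * (2 * N) * (2 * π / L) ^ 2 * Λ ^ 2 := by gcongr
        _ = 4 * (2 * π / L) ^ 2 * (Λ * N) ^ 2 := by ring
        _ ≤ 4 * (2 * π / L) ^ 2 * e₀ ^ 2 := by gcongr
        _ ≤ 36 * (2 * π / L) ^ 2 * e₀ ^ 2 := by
            have h0 : 0 ≤ (2 * π / (L : ℝ)) ^ 2 * e₀ ^ 2 := by positivity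
            linarith only [h0]
    · rw [hκ]; ring
  -- the normal step (`s = U`)
  have h2' : ∀ q, ‖((fwdDiff ((0 : TorusSite 1 (2 * M)), (fun j => ((((![-v 1, v 0] : Fin 2 → ℤ) j : ℤ)) : ZMod L))))^[2] Gs) q‖ ≤
      1 * (4 / (4 * Λ / (L * U * Real.sqrt κ) * L)) ^ 2 := by
    intro q
    have hraw := norm_fwdDiff_two_space_klAnisoPair_le B hA hADt he hz hz1 hgap h3 hlo hhi hn ω₁ ω₂ hd.le hd1 hd2 hZ hΦ hGs hB0.le hB
      (![-v 1, v 0]) huperp (abs_fderiv_frameBand_apply_le hA μ _ _) q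
    rw [rate_perp_sq hκ0 hΛ hL hU0]
    refine hraw.trans ?_
    rw [← hcG, ← hc1, ← hρdef]
    set W : ℝ := ‖(fun j : Fin 2 => 2 * π / L * (((![-v 1, v 0] : Fin 2 → ℤ) j : ℤ) : ℝ))‖ with hWdef
    set Wm : ℝ := ‖momToComplex (fun j : Fin 2 => 2 * π / L * (((![-v 1, v 0] : Fin 2 → ℤ) j : ℤ) : ℝ))‖ with hWmdef
    have hW0 : 0 ≤ W := norm_nonneg _
    have hWm0 : 0 ≤ Wm := norm_nonneg _
    refine (kx_le (s := U) (Y := Y) (aw := 9 / 4) (ad := 12) (a2 := 72) (a3 := 36) (e₀ := e₀) hcG0.le hc10 hB0.le hA0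
      hΛ hρ0 (by positivity) hW0 hWm0 hD₁0 hD₂0 hU0.le hY0 ?_ ?_ ?_ ?_ ?_).trans (le_of_eq ?_)
    · rw [hY]
      have h1 : ρ + 2 * W ≤ 2 * ρb + 5 := by linarith only [hρb', hWp, hU, hρb0]
      have h2 : (4 + 4 * A) * (ρ + 2 * W) * W ≤ (4 + 4 * A) * (2 * ρb + 5) * U := by gcongr
      have h3 : (4 + 2 * A) * W ≤ (4 + 2 * A) * U := by gcongr
      linarith only [h2, h3]
    · calc W ^ 2 * Λ ≤ U ^ 2 * e₀ := by gcongr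
        _ ≤ 9 / 4 * U ^ 2 * e₀ := by
            have h0 : 0 ≤ U ^ 2 * e₀ := by positivity
            linarith only [h0]
    · calc ((1 + 2 * (sectorWidth n₁)⁻¹) + (1 + 2 * (sectorWidth n₂)⁻¹)) * Wm * Λ ≤ (2 * N + 2 * N) * (2 * U) * Λ := by gcongr
        _ = 8 * U * (Λ * N) := by ring
        _ ≤ 8 * U * e₀ := by gcongr
        _ ≤ 12 * U * e₀ := by
            have h0 : 0 ≤ U * e₀ := by positivity
            linarith only [h0]
    · have hsq₁ : (1 + 2 * (sectorWidth n₁)⁻¹) ^ 2 ≤ (2 * N) ^ 2 := pow_le_pow_left₀ hD₁0 hD₁ 2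
      have hsq₂ : (1 + 2 * (sectorWidth n₂)⁻¹) ^ 2 ≤ (2 * N) ^ 2 := pow_le_pow_left₀ hD₂0 hD₂ 2
      have hsqW : Wm ^ 2 ≤ (2 * U) ^ 2 := pow_le_pow_left₀ hWm0 hWmp 2
      calc ((1 + 2 * (sectorWidth n₁)⁻¹) ^ 2 + (1 + 2 * (sectorWidth n₂)⁻¹) ^ 2) * Wm ^ 2 * Λ ^ 2 ≤
          ((2 * N) ^ 2 + (2 * N) ^ 2) * (2 * U) ^ 2 * Λ ^ 2 := by gcongr
        _ = 32 * U ^ 2 * (Λ * N) ^ 2 := by ring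
        _ ≤ 32 * U ^ 2 * e₀ ^ 2 := by gcongr
        _ ≤ 72 * U ^ 2 * e₀ ^ 2 := by
            have h0 : 0 ≤ U ^ 2 * e₀ ^ 2 := by positivity
            linarith only [h0]
    · have hsqW : Wm ^ 2 ≤ (2 * U) ^ 2 := pow_le_pow_left₀ hWm0 hWmp 2
      calc (1 + 2 * (sectorWidth n₁)⁻¹) * (1 + 2 * (sectorWidth n₂)⁻¹) * Wm ^ 2 * Λ ^ 2 ≤
          (2 * N) * (2 * N) * (2 * U) ^ 2 * Λ ^ 2 := by gcongr
        _ = 16 * U ^ 2 * (Λ * N) ^ 2 := by ring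
        _ ≤ 16 * U ^ 2 * e₀ ^ 2 := by gcongr
        _ ≤ 36 * U ^ 2 * e₀ ^ 2 := by
            have h0 : 0 ≤ U ^ 2 * e₀ ^ 2 := by positivity
            linarith only [h0]
    · rw [hκ]; ring
  -- the tangent step (`s = h`, tangency `τ₀ = h(4 + 2A)`)
  have h3' : ∀ q, ‖((fwdDiff ((0 : TorusSite 1 (2 * M)), (fun j => ((v j : ℤ) : ZMod L))))^[2] Gs) q‖ ≤
      1 * (4 / (2 * Λ / (π * Real.sqrt κ) * L)) ^ 2 := by
    intro q
    have hraw := norm_fwdDiff_two_space_klAnisoPair_le B hA hADt he hz hz1 hgap h3 hlo hhi hn ω₁ ω₂ hd.le hd1 hd2 hZ hΦ hGs hB0.le hB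
      v huv hτv q
    rw [rate_space_sq hκ0 hΛ hL]
    refine hraw.trans ?_
    rw [← hcG, ← hc1, ← hρdef, habs]
    set W : ℝ := ‖(fun j : Fin 2 => 2 * π / L * (v j : ℝ))‖ with hWdef
    set Wm : ℝ := ‖momToComplex (fun j : Fin 2 => 2 * π / L * (v j : ℝ))‖ with hWmdef
    have hW0 : 0 ≤ W := norm_nonneg _
    have hWm0 : 0 ≤ Wm := norm_nonneg _
    have hWN : W ≤ 3 / 2 * (2 * π / L * N) := hWv.trans hU32
    have hWmN : Wm ≤ 3 * (2 * π / L * N) := hWmv.trans (by linarith)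
    refine (kx_le (s := 2 * π / L) (Y := Y) (aw := 9 / 4) (ad := 12) (a2 := 72) (a3 := 36) (e₀ := e₀) hcG0.le hc10 hB0.le hA0
      hΛ hρ0 (by positivity) hW0 hWm0 hD₁0 hD₂0 hc.le hY0 ?_ ?_ ?_ ?_ ?_).trans (le_of_eq ?_)
    · rw [hY]
      have h1 : (ρ + 2 * W) * W ≤ 3 / 2 * ρb * (2 * π / L) + 9 / 2 * (2 * π / L) := by
        have hρW : ρ * W ≤ ρb / N * (3 / 2 * (2 * π / L * N)) := mul_le_mul hρN hWN hW0 (by positivity)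
        have e1 : ρb / N * (3 / 2 * (2 * π / L * N)) = 3 / 2 * ρb * (2 * π / L) := by field_simp
        have hW2 : W * W ≤ (3 / 2 * (2 * π / L * N)) * (3 / 2 * (2 * π / L * N)) := mul_le_mul hWN hWN hW0 (by positivity)
        have hhN : (2 * π / L * N) * (2 * π / L * N) ≤ 2 * π / L := by
          have : (2 * π / L * N) * (2 * π / L * N) = 2 * π / L * (2 * π / L * N ^ 2) := by ring
          rw [this]; exact mul_le_of_le_one_right hc.le hhN2
        rw [e1] at hρW
        have hexp : (ρ + 2 * W) * W = ρ * W + 2 * (W * W) := by ring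
        rw [hexp]
        linarith only [hρW, hW2, hhN]
      have h2 : (4 + 4 * A) * (ρ + 2 * W) * W ≤ (4 + 4 * A) * (3 / 2 * ρb * (2 * π / L) + 9 / 2 * (2 * π / L)) := by
        rw [mul_assoc]; exact mul_le_mul_of_nonneg_left h1 (by linarith only [hA0])
      have hρs : 0 ≤ (4 + 4 * A) * (ρb * (2 * π / (L : ℝ))) := by positivity
      have hs0 : 0 ≤ (4 + 4 * A) * (2 * π / (L : ℝ)) := by positivity
      linarith only [h2, hρs, hs0]
    · have hW2 : W ^ 2 ≤ (3 / 2 * (2 * π / L * N)) ^ 2 := pow_le_pow_left₀ hW0 hWN 2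
      calc W ^ 2 * Λ ≤ (3 / 2 * (2 * π / L * N)) ^ 2 * Λ := by gcongr
        _ = 9 / 4 * (2 * π / L) ^ 2 * (Λ * N ^ 2) := by ring
        _ = 9 / 4 * (2 * π / L) ^ 2 * e₀ := by rw [hΛN2]
    · calc ((1 + 2 * (sectorWidth n₁)⁻¹) + (1 + 2 * (sectorWidth n₂)⁻¹)) * Wm * Λ ≤
          (2 * N + 2 * N) * (3 * (2 * π / L * N)) * Λ := by gcongr
        _ = 12 * (2 * π / L) * (Λ * N ^ 2) := by ring
        _ = 12 * (2 * π / L) * e₀ := by rw [hΛN2]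
    · have hsq₁ : (1 + 2 * (sectorWidth n₁)⁻¹) ^ 2 ≤ (2 * N) ^ 2 := pow_le_pow_left₀ hD₁0 hD₁ 2
      have hsq₂ : (1 + 2 * (sectorWidth n₂)⁻¹) ^ 2 ≤ (2 * N) ^ 2 := pow_le_pow_left₀ hD₂0 hD₂ 2
      have hsqW : Wm ^ 2 ≤ (3 * (2 * π / L * N)) ^ 2 := pow_le_pow_left₀ hWm0 hWmN 2
      calc ((1 + 2 * (sectorWidth n₁)⁻¹) ^ 2 + (1 + 2 * (sectorWidth n₂)⁻¹) ^ 2) * Wm ^ 2 * Λ ^ 2 ≤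
          ((2 * N) ^ 2 + (2 * N) ^ 2) * (3 * (2 * π / L * N)) ^ 2 * Λ ^ 2 := by gcongr
        _ = 72 * (2 * π / L) ^ 2 * (Λ * N ^ 2) ^ 2 := by ring
        _ = 72 * (2 * π / L) ^ 2 * e₀ ^ 2 := by rw [hΛN2]
    · have hsqW : Wm ^ 2 ≤ (3 * (2 * π / L * N)) ^ 2 := pow_le_pow_left₀ hWm0 hWmN 2
      calc (1 + 2 * (sectorWidth n₁)⁻¹) * (1 + 2 * (sectorWidth n₂)⁻¹) * Wm ^ 2 * Λ ^ 2 ≤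
          (2 * N) * (2 * N) * (3 * (2 * π / L * N)) ^ 2 * Λ ^ 2 := by gcongr
        _ = 36 * (2 * π / L) ^ 2 * (Λ * N ^ 2) ^ 2 := by ring
        _ = 36 * (2 * π / L) ^ 2 * e₀ ^ 2 := by rw [hΛN2]
    · rw [hκ]; ring
  have hsup := norm_klAnisoPair_le_one hA he hz h3 ω₁ ω₂ hZ hΦ hGs
  have hNs := card_support_klAnisoPair_le B hA hADt he hz hz1 hgap h3 hlo hhi hβ hρA hn ω₁ ω₂ hd.le hd1 hd2 hZ hΦ hGs
  rw [← hρdef] at hNs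
  -- the master lemma at the clean rates
  have hs₀ : 0 < 2 * Λ * β / (((2 * M : ℕ) : ℝ) * π * Real.sqrt cG) := by
    have : 0 < Real.sqrt cG := Real.sqrt_pos.2 hcG0
    positivity
  have hsκ : 0 < Real.sqrt κ := Real.sqrt_pos.2 hκ0
  have hs₁ : 0 < 2 * Λ / (π * Real.sqrt κ) := by positivity
  have hs₂ : 0 < 4 * Λ / (L * U * Real.sqrt κ) := by positivity
  have main := sum_norm_charSum_le_of_second_differences Gs v hv hs₀ hs₁ hs₂ hs₁ hR₀ zero_le_one (le_refl _) hsup h0' h1' h2' h3'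
  refine main.trans ?_
  -- the final bookkeeping
  have hP : ((2 * M : ℕ) : ℝ) = 2 * (M : ℝ) := by push_cast; ring
  rw [hP]
  have hΛβM : Λ * β ≤ M := (mul_le_mul_of_nonneg_right hΛe hβ.le).trans (by rw [mul_comm]; exact hMβ)
  have htfac : 1 / (2 * Λ * β / (2 * (M : ℝ) * π * Real.sqrt cG)) + 1 ≤ M / (Λ * β) * (π * Real.sqrt cG + 1) :=
    tfac_le hcG0 hΛ hβ hMpos hΛβM
  have hnear2 := near_perp_le (V := Real.sqrt ((v 0 : ℝ) ^ 2 + (v 1 : ℝ) ^ 2)) hκ0 hΛ hL hU0 hN0 hV hLU hΛe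
  have hnear3 := near_tan_le (V := Real.sqrt ((v 0 : ℝ) ^ 2 + (v 1 : ℝ) ^ 2)) hκ0 hΛ hN0 hV hΛN
  have hfar := far_le (R₀ := (R₀ : ℝ)) hκ0 hΛ hL hN0 he hΛe hR₀' hLΛ2
  have hn3 : 0 ≤ 2 * Real.sqrt 2 / (2 * Λ / (π * Real.sqrt κ) * Real.sqrt ((v 0 : ℝ) ^ 2 + (v 1 : ℝ) ^ 2)) + 2 := by positivity
  have hbr := bracket_le hΛ hN0 hΛN2 hn3 hnear2 hnear3 hfar
  rw [← hκX] at hbr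
  have hsupp := supp_le (K₂ := 4 + 4 * A) (γ := 2 * B.rhomin - 4 * A) hΛ hβ hL hN1 hρ0 hρN (by linarith) hγ hΛN2 hN2L hΛβ
  rw [← hcN1, ← hcN2] at hsupp
  have hX1 : 2048 * (1 / (2 * Λ * β / (2 * (M : ℝ) * π * Real.sqrt cG)) + 1) *
      (4 * ((2 * Real.sqrt 2 / (4 * Λ / (L * U * Real.sqrt κ) * Real.sqrt ((v 0 : ℝ) ^ 2 + (v 1 : ℝ) ^ 2)) + 2) *
        (2 * Real.sqrt 2 / (2 * Λ / (π * Real.sqrt κ) * Real.sqrt ((v 0 : ℝ) ^ 2 + (v 1 : ℝ) ^ 2)) + 2)) +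
        16 * (1 / (2 * Λ / (π * Real.sqrt κ)) + 1) ^ 2 / (1 + 2 * Λ / (π * Real.sqrt κ) * (R₀ : ℝ))) ≤
      2048 * (π * Real.sqrt cG + 1) * κX * (M / (Λ * β)) * (N / Λ) := by
    calc _ ≤ 2048 * (M / (Λ * β) * (π * Real.sqrt cG + 1)) * (N / Λ * κX) := by gcongr
      _ = 2048 * (π * Real.sqrt cG + 1) * κX * (M / (Λ * β)) * (N / Λ) := by ring
  have hX2 : 16 * (2 * (M : ℝ)) * (L : ℝ) ^ 2 *
      ((((univ : Finset (TorusSite 1 (2 * M) × TorusSite 2 L)).filter fun q => Gs q ≠ 0).card : ℕ) : ℝ) ≤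
      160 / π * (cN1 * cN2) * M * (Λ * β) * ((L : ℝ) ^ 2 * ((L : ℝ) ^ 2 / N ^ 3)) := by
    calc _ ≤ 16 * (2 * (M : ℝ)) * (L : ℝ) ^ 2 * (5 * Λ * β / π * ((L : ℝ) ^ 2 / N ^ 3) * (cN1 * cN2)) := by
          gcongr; exact hNs.trans hsupp
      _ = 160 / π * (cN1 * cN2) * M * (Λ * β) * ((L : ℝ) ^ 2 * ((L : ℝ) ^ 2 / N ^ 3)) := by ring
  exact sqrt_mul_sqrt_le (a := 2048 * (π * Real.sqrt cG + 1) * κX) (b := 160 / π * (cN1 * cN2)) (N := N) (Λ := Λ) (β := β)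
    (by positivity) (by positivity) (by positivity) (by positivity) hMpos.le hΛ hβ hN0 hΛN2 hX1 hX2

end Main

end Summit.HubbardSuperconductivity.HubbardSuperconductivity.Theorems.TorusFourierL2

end
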